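import Literature.Computability.AlgebraicComplexity.DeterminantalConormalBoundProofs
import Mathlib.Algebra.MvPolynomial.Funext
import HarnessLib

/-!
# Linear algebra of the kernel-incidence system: affine expansion, kernel lines, left reduction

Topic: `Literature/Computability/AlgebraicComplexity`. Auxiliary results for the application of
the multigraded refined Bézout count to Sheshadri's kernel-incidence system
(arXiv:2606.13628, §3.1 Steps 2–4):

* `eq_C_add_sum_of_totalDegree_le_one`, `eval_eq_coeff_zero_add_sum` — an affine-linear
  polynomial (`totalDegree ≤ 1`) is `p = p₀ + Σᵢ pᵢ Xᵢ` with `p₀ = coeff 0 p`, `pᵢ = coeff eᵢ p`;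
* `exists_smul_of_mulVec_eq_zero`, `exists_smul_of_vecMul_eq_zero` — for a square matrix over a
  field with `det = 0` and `adj ≠ 0` (corank exactly one) the right and left kernels are lines;
* `vecMul_eq_zero_of_left_reduction` — the left (transposed, denominator-free) form of
  `mulVec_eq_zero_of_reduction`: if `A v = 0`, `v_{i₀} ≠ 0` and `det (Λᵀ B'_v) ≠ 0` for the
  explicit polynomial basis `B'_v = v_{i₀} · B_v` of `v^⊥`, then `(uᵀ A) Λ = 0 ⇒ uᵀ A = 0`;
* `exists_left_reduction_matrix` — one matrix `Λ ∈ ℂ^{(m+1) × m}` generic for finitely many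
  kernel vectors (all `det (Λᵀ B'_{v_x}) ≠ 0`) and with no column of `Â Λ` vanishing.

[cite: Sheshadri2026Border, §3.1 Steps 2–3] for the roles of these statements; the proofs are
[folklore] linear algebra.
-/

noncomputable section

open MvPolynomial Matrix

namespace Literature.Computability.AlgebraicComplexity

namespace DeterminantalConormal

/-! ## Affine-linear polynomials -/

/-- An exponent vector of degree `≤ 1` is `0` or a unit vector. [folklore] -/
theorem finsupp_eq_zero_or_single_of_degree_le_one {σ : Type*} {s : σ →₀ ℕ}
    (hs : s.degree ≤ 1) : s = 0 ∨ ∃ i, s = Finsupp.single i 1 := by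
  classical
  by_cases h0 : s = 0
  · exact Or.inl h0
  right
  have hne : s.support.Nonempty := by
    rw [Finset.nonempty_iff_ne_empty, Ne, Finsupp.support_eq_empty]
    exact h0
  obtain ⟨i, hi⟩ := hne
  have hsi : 1 ≤ s i := Nat.one_le_iff_ne_zero.mpr (Finsupp.mem_support_iff.mp hi)
  have hle : Finsupp.single i 1 ≤ s := Finsupp.single_le_iff.mpr hsi
  obtain ⟨t, ht⟩ := exists_add_of_le hle
  have hdeg : (Finsupp.single i 1).degree + t.degree ≤ 1 := by
    rw [← map_add, ← ht]; exact hs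
  rw [Finsupp.degree_single] at hdeg
  have ht0 : t = 0 := (Finsupp.degree_eq_zero_iff t).mp (by omega)
  refine ⟨i, ?_⟩
  rw [ht, ht0, add_zero]

/-- **Affine expansion**: a polynomial of total degree `≤ 1` is
`C (coeff 0 p) + Σᵢ C (coeff eᵢ p) · Xᵢ`. [folklore] -/
theorem eq_C_add_sum_of_totalDegree_le_one {R : Type*} [CommSemiring R] {σ : Type*} [Fintype σ]
    {p : MvPolynomial σ R} (hp : p.totalDegree ≤ 1) :
    p = C (coeff 0 p) + ∑ i, C (coeff (Finsupp.single i 1) p) * X i := by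
  classical
  ext s
  simp only [coeff_add, coeff_C, coeff_sum, coeff_C_mul, coeff_X]
  by_cases hs0 : s = 0
  · subst hs0
    rw [if_pos rfl, Finset.sum_eq_zero (fun i _ => ?_), add_zero]
    rw [if_neg (Finsupp.single_ne_zero.mpr one_ne_zero), mul_zero]
  rw [if_neg (Ne.symm hs0), zero_add]
  by_cases hs1 : ∃ i, s = Finsupp.single i 1
  · obtain ⟨i, rfl⟩ := hs1
    rw [Finset.sum_eq_single i]
    · rw [if_pos rfl, mul_one]
    · intro j _ hji
      rw [if_neg (fun h => hji (Finsupp.single_left_injective one_ne_zero h)), mul_zero]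
    · intro h; exact absurd (Finset.mem_univ i) h
  · -- `s` has degree `≥ 2`: both sides vanish
    have hl : coeff s p = 0 := by
      by_contra h
      have hmem : s ∈ p.support := mem_support_iff.mpr h
      have hdeg : s.degree ≤ 1 := (le_totalDegree hmem).trans hp
      rcases finsupp_eq_zero_or_single_of_degree_le_one hdeg with h | h
      · exact hs0 h
      · exact hs1 h
    rw [hl, eq_comm]
    refine Finset.sum_eq_zero fun i _ => ?_
    rw [if_neg (fun h => hs1 ⟨i, h.symm⟩), mul_zero]

/-- Hence `p(x) = coeff 0 p + Σᵢ coeff eᵢ p · xᵢ` for `p` of total degree `≤ 1`. [folklore] -/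
theorem eval_eq_coeff_zero_add_sum {R : Type*} [CommSemiring R] {σ : Type*} [Fintype σ]
    {p : MvPolynomial σ R} (hp : p.totalDegree ≤ 1) (x : σ → R) :
    eval x p = coeff 0 p + ∑ i, coeff (Finsupp.single i 1) p * x i := by
  conv_lhs => rw [eq_C_add_sum_of_totalDegree_le_one hp]
  simp only [map_add, map_sum, map_mul, eval_C, eval_X]

/-- An affine-linear polynomial vanishes iff its constant and linear coefficients do.
[folklore] -/
theorem eq_zero_iff_of_totalDegree_le_one {R : Type*} [CommSemiring R] {σ : Type*} [Fintype σ]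
    {p : MvPolynomial σ R} (hp : p.totalDegree ≤ 1) :
    p = 0 ↔ coeff 0 p = 0 ∧ ∀ i, coeff (Finsupp.single i 1) p = 0 := by
  constructor
  · rintro rfl; simp
  · rintro ⟨h0, h1⟩
    rw [eq_C_add_sum_of_totalDegree_le_one hp, h0, C_0, zero_add]
    exact Finset.sum_eq_zero fun i _ => by rw [h1 i, C_0, zero_mul]

/-! ## Kernel lines of a corank-one matrix -/

section KernelLines

variable {K : Type*} [Field K] {k : ℕ}

/-- **Right kernel line**: if `det M = 0` and `adj M ≠ 0` (so `rank M = k − 1`,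
`rank_eq_of_det_eq_zero_of_adjugate_ne_zero`), every right kernel vector is a multiple of a
given non-zero one ("the lift `[v*]` is unique", §3.1 Step 2). [folklore] -/
theorem exists_smul_of_mulVec_eq_zero {M : Matrix (Fin k) (Fin k) K} (hdet : M.det = 0)
    (hadj : M.adjugate ≠ 0) {v : Fin k → K} (hv : v ≠ 0) (hMv : M *ᵥ v = 0)
    (v' : Fin k → K) (hMv' : M *ᵥ v' = 0) : ∃ c : K, v' = c • v := by
  have hrank := rank_eq_of_det_eq_zero_of_adjugate_ne_zero hdet hadj
  have hk : 1 ≤ k := by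
    rcases Nat.eq_zero_or_pos k with h | h
    · subst h; exact absurd (Subsingleton.elim v 0) hv
    · exact h
  have hker : Module.finrank K (LinearMap.ker M.mulVecLin) = 1 := by
    have h := LinearMap.finrank_range_add_finrank_ker M.mulVecLin
    rw [Module.finrank_fintype_fun_eq_card, Fintype.card_fin] at h
    have hr : Module.finrank K (LinearMap.range M.mulVecLin) = k - 1 := hrank
    omega
  have hvmem : v ∈ LinearMap.ker M.mulVecLin := by
    rw [LinearMap.mem_ker, Matrix.mulVecLin_apply]; exact hMv
  have hv'mem : v' ∈ LinearMap.ker M.mulVecLin := by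
    rw [LinearMap.mem_ker, Matrix.mulVecLin_apply]; exact hMv'
  have hne : (⟨v, hvmem⟩ : LinearMap.ker M.mulVecLin) ≠ 0 := fun h =>
    hv (congrArg Subtype.val h)
  obtain ⟨c, hc⟩ := (finrank_eq_one_iff_of_nonzero' _ hne).mp hker ⟨v', hv'mem⟩
  exact ⟨c, (congrArg Subtype.val hc).symm⟩

/-- **Left kernel line**: the transposed statement ("the lift `[u*]` is unique").
[folklore] -/
theorem exists_smul_of_vecMul_eq_zero {M : Matrix (Fin k) (Fin k) K} (hdet : M.det = 0)
    (hadj : M.adjugate ≠ 0) {u : Fin k → K} (hu : u ≠ 0) (huM : u ᵥ* M = 0)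
    (u' : Fin k → K) (hu'M : u' ᵥ* M = 0) : ∃ c : K, u' = c • u := by
  have hdet' : Mᵀ.det = 0 := by rw [det_transpose, hdet]
  have hadj' : Mᵀ.adjugate ≠ 0 := by
    intro h
    apply hadj
    rw [← transpose_transpose M.adjugate, adjugate_transpose, h, transpose_zero]
  exact exists_smul_of_mulVec_eq_zero hdet' hadj' hu (by rw [mulVec_transpose, huM]) u'
    (by rw [mulVec_transpose, hu'M])

end KernelLines

/-! ## The left reduction (transposed, denominator-free form of Step 3) -/

section LeftReduction

variable {m : ℕ}

/-- **Left reduction at a point** (transposed form of `mulVec_eq_zero_of_reduction`,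
arXiv:2606.13628 §3.1 Step 3): if `A v = 0` with `v_{i₀} ≠ 0`, `Λ ∈ ℂ^{(m+1) × m}` and
`det (Λᵀ B'_v) ≠ 0` for the denominator-free hyperplane basis
`B'_v = (v_{i₀} e_{σ j} − v_{σ j} e_{i₀})_j` (`σ = i₀.succAbove`) of `v^⊥ ⊇ {uᵀ A}`, then
`(uᵀ A) Λ = 0` forces `uᵀ A = 0`. [cite: Sheshadri2026Border, §3.1 Step 3] -/
theorem vecMul_eq_zero_of_left_reduction {A : Matrix (Fin (m + 1)) (Fin (m + 1)) ℂ}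
    {v : Fin (m + 1) → ℂ} (hv : A *ᵥ v = 0) {i₀ : Fin (m + 1)} (hi₀ : v i₀ ≠ 0)
    (Λ : Matrix (Fin (m + 1)) (Fin m) ℂ)
    (hdet : (Λᵀ * Matrix.of (fun i j => if i = i₀.succAbove j then v i₀
      else if i = i₀ then -(v (i₀.succAbove j)) else 0)).det ≠ 0)
    (u : Fin (m + 1) → ℂ) (hu : (u ᵥ* A) ᵥ* Λ = 0) : u ᵥ* A = 0 := by
  have hn : v ᵥ* Aᵀ = 0 := by rw [vecMul_transpose, hv]
  have hB : (Matrix.of (fun i j => if i = i₀.succAbove j then v i₀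
      else if i = i₀ then -(v (i₀.succAbove j)) else 0) : Matrix (Fin (m + 1)) (Fin m) ℂ) =
      v i₀ • Matrix.of (fun i j => if i = i₀.succAbove j then (1 : ℂ)
        else if i = i₀ then -(v (i₀.succAbove j)) / v i₀ else 0) := by
    ext i j
    simp only [Matrix.of_apply, Matrix.smul_apply, smul_eq_mul]
    split_ifs
    · rw [mul_one]
    · field_simp
    · rw [mul_zero]
  have hdet' : (Λᵀ * Matrix.of (fun i j => if i = i₀.succAbove j then (1 : ℂ)
      else if i = i₀ then -(v (i₀.succAbove j)) / v i₀ else 0)).det ≠ 0 := by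
    intro h
    apply hdet
    rw [hB, Matrix.mul_smul, det_smul, h, mul_zero]
  have h := mulVec_eq_zero_of_reduction hn hi₀ Λᵀ hdet' u
    (by rw [mulVec_transpose, mulVec_transpose, hu])
  rwa [mulVec_transpose] at h

/-- **A reduction matrix generic for finitely many kernel vectors and for the columns**
(arXiv:2606.13628 §3.1 Step 3, both open conditions at once): given finitely many vectors `v_x`
with marked non-zero coordinates `i₀(x)` and a non-zero polynomial matrix `Â`, some
`Λ ∈ ℂ^{(m+1) × m}` has `det (Λᵀ B'_{v_x}) ≠ 0` for all `x` and no column of `Â Λ` vanishing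
identically (each column has a non-zero entry). [cite: Sheshadri2026Border, §3.1 Step 3] -/
theorem exists_left_reduction_matrix {α : Type*} (P : Finset α) (v : α → Fin (m + 1) → ℂ)
    (i₀ : α → Fin (m + 1)) (hv : ∀ x ∈ P, v x (i₀ x) ≠ 0) {τ : Type*}
    (Ahat : Matrix (Fin (m + 1)) (Fin (m + 1)) (MvPolynomial τ ℂ)) (hA : Ahat ≠ 0) :
    ∃ Λ : Matrix (Fin (m + 1)) (Fin m) ℂ,
      (∀ x ∈ P, (Λᵀ * Matrix.of (fun i j => if i = (i₀ x).succAbove j then v x (i₀ x)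
        else if i = i₀ x then -(v x ((i₀ x).succAbove j)) else 0)).det ≠ 0) ∧
      ∀ j : Fin m, ∃ k, (Ahat * Λ.map (fun a : ℂ => (C a : MvPolynomial τ ℂ))) k j ≠ 0 := by
  classical
  -- genericity polynomial for the kernel vectors, in the entries of `Λᵀ`
  set XΛ : Matrix (Fin m) (Fin (m + 1)) (MvPolynomial (Fin m × Fin (m + 1)) ℂ) :=
    Matrix.of fun i j => X (i, j) with hXΛ
  set B : α → Matrix (Fin (m + 1)) (Fin m) ℂ := fun x => Matrix.of (fun i j =>
    if i = (i₀ x).succAbove j then v x (i₀ x)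
    else if i = i₀ x then -(v x ((i₀ x).succAbove j)) else 0) with hBdef
  set Ψ₁ : MvPolynomial (Fin m × Fin (m + 1)) ℂ := ∏ x ∈ P, (XΛ * (B x).map C).det with hΨ₁
  have hevalB : ∀ (M : Matrix (Fin m) (Fin (m + 1)) ℂ) x,
      eval (fun ij : Fin m × Fin (m + 1) => M ij.1 ij.2) ((XΛ * (B x).map C).det) =
        (M * B x).det := by
    intro M x
    rw [RingHom.map_det, RingHom.mapMatrix_apply, Matrix.map_mul, Matrix.map_map]
    have hX : XΛ.map (eval fun ij : Fin m × Fin (m + 1) => M ij.1 ij.2) = M := by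
      ext i j; simp [hXΛ]
    have hBB : (B x).map (⇑(eval fun ij : Fin m × Fin (m + 1) => M ij.1 ij.2) ∘ ⇑C) = B x := by
      ext i j; simp
    rw [hX, hBB]
  have hΨ₁0 : Ψ₁ ≠ 0 := by
    refine Finset.prod_ne_zero_iff.mpr fun x hx h0 => ?_
    set Λ₀ : Matrix (Fin m) (Fin (m + 1)) ℂ :=
      Matrix.of fun j i => if i = (i₀ x).succAbove j then 1 else 0 with hΛ₀
    have h1 := congrArg (eval (fun ij : Fin m × Fin (m + 1) => Λ₀ ij.1 ij.2)) h0
    rw [hevalB, map_zero] at h1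
    have hone : Λ₀ * B x = v x (i₀ x) • (1 : Matrix (Fin m) (Fin m) ℂ) := by
      ext j j'
      rw [Matrix.mul_apply, Finset.sum_eq_single ((i₀ x).succAbove j)]
      · simp only [hΛ₀, hBdef, Matrix.of_apply, if_true, one_mul, Matrix.smul_apply,
          Matrix.one_apply, smul_eq_mul, mul_ite, mul_one, mul_zero]
        by_cases hjj : j = j'
        · subst hjj; simp
        · rw [if_neg (fun h => hjj (Fin.succAbove_right_injective h)),
            if_neg (Fin.succAbove_ne (i₀ x) j), if_neg hjj]
      · intro i _ hi
        simp only [hΛ₀, Matrix.of_apply, if_neg hi, zero_mul]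
      · intro h; exact absurd (Finset.mem_univ _) h
    rw [hone, det_smul, det_one, mul_one, Fintype.card_fin] at h1
    exact pow_ne_zero _ (hv x hx) h1
  -- genericity polynomial for the columns (rows of `Λᵀ Âᵀ`), from the tree lemma
  have hAt : Ahatᵀ ≠ 0 := fun h => hA (by rw [← transpose_transpose Ahat, h, transpose_zero])
  obtain ⟨Ψ₂, hΨ₂0, hΨ₂⟩ := exists_generic_rows_ne_zero Ahatᵀ hAt
  -- a common non-root
  have hΨ : Ψ₁ * Ψ₂ ≠ 0 := mul_ne_zero hΨ₁0 hΨ₂0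
  obtain ⟨pt, hpt⟩ : ∃ pt : Fin m × Fin (m + 1) → ℂ, eval pt (Ψ₁ * Ψ₂) ≠ 0 := by
    by_contra h
    push Not at h
    exact hΨ (MvPolynomial.funext fun x => by rw [h x, map_zero])
  rw [map_mul] at hpt
  set Λt : Matrix (Fin m) (Fin (m + 1)) ℂ := Matrix.of fun i j => pt (i, j) with hΛt
  have hpt' : pt = fun ij : Fin m × Fin (m + 1) => Λt ij.1 ij.2 := by
    funext ij; simp [hΛt]
  refine ⟨Λtᵀ, fun x hx => ?_, fun j => ?_⟩
  · have h1 := left_ne_zero_of_mul hpt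
    rw [hΨ₁, map_prod, Finset.prod_ne_zero_iff] at h1
    have h2 := h1 x hx
    rw [hpt', hevalB] at h2
    rwa [transpose_transpose]
  · have h2 := hΨ₂ Λt (by rw [← hpt']; exact right_ne_zero_of_mul hpt) j
    obtain ⟨k, hk⟩ := Function.ne_iff.mp h2
    refine ⟨k, ?_⟩
    rw [Matrix.mul_apply, Pi.zero_apply] at hk
    rw [Matrix.mul_apply]
    convert hk using 1
    refine Finset.sum_congr rfl fun l _ => ?_
    rw [Matrix.map_apply, Matrix.transpose_apply, Matrix.map_apply, Matrix.transpose_apply,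
      mul_comm]

end LeftReduction

end DeterminantalConormal

end Literature.Computability.AlgebraicComplexity

end
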